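import Literature.MeasureTheory.Group.InvariantOrbitMeasureUniqueness
import Literature.NumberTheory.Automorphic.GLnDotProductOrbitTransitive
import Literature.NumberTheory.Automorphic.TateLocalZetaShells
import Mathlib.LinearAlgebra.Matrix.GeneralLinearGroup.Defs
import Mathlib.Topology.Instances.Matrix
import Mathlib.NumberTheory.LocalField.Basic
import HarnessLib

/-!
# Uniqueness of `GL_N(K)`-invariant measures on the fibres of the split form `x ⬝ᵥ y`
(Weil, *Sur la formule de Siegel dans la théorie des groupes classiques* (1965), n° 49, Lemme 22 and
n° 50, proof of Thm 4, (39)–(40), at the one place `v` split in `E/F`)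

Topic `NumberTheory/Weil1965`; namespace `Literature.NumberTheory.Weil1965.SplitPlace`; theorems only
(no definition, no instance, no named fact). Companion of `SplitPlaceSliceDensity` /
`SplitPlaceFibreDensity` (row I-SPLIT of the E2-SW table of crux H413) and the split-place instance
of the generic `Literature.MeasureTheory.Group.InvariantOrbitMeasureUniqueness` (row I-UNIQ).

SETTING. `K` a non-archimedean local field, `n` a finite index type, `X = Kⁿ × Kⁿ` with the SPLIT
FORM `h(x, y) = x ⬝ᵥ y`, and the action of `GL_n(K)` by `g · (x, y) = (g x, g⁻ᵀ y)` — the shape of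
`U(V)(F_v) ≅ GL_N(F_v)` acting on `V_v = F_vᴺ × F_vᴺ` at a place `v` of `F` split in `E`. For
`b : K` write `S_b = {(x, y) | x ⬝ᵥ y = b, x ≠ 0, y ≠ 0}` (Weil's `U(b)_v`: the points of maximal rank
on the fibre). All statements are **instance-free**: invariance of a measure `μ` on `X` is the
hypothesis `∀ g A, MeasurableSet A → μ (T_g ⁻¹' A) = μ A` with
`T_g z = (g *ᵥ z.1, (g⁻¹)ᵀ *ᵥ z.2)` written out, and «carried by `S_b`» is `μ S_bᶜ = 0`; the
`GL_n(K)`-action on `X`, its continuity and the Borel structure of `GL_n(K)` are manufactured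
inside the proofs (`letI`), so that nothing global is declared. TRANSITIVITY of `GL_n(K)` on `S_b`
(`2 ≤ |n|`, every `b`, including the cone `b = 0`) is
`Literature.NumberTheory.Automorphic.GLnDotProduct.exists_gl_mulVec_eq_and_transpose_inv_mulVec_eq_of_dotProduct_eq`
(row G2-SPLIT), consumed by name.

* `mem_splitLocus_of_mem` — `S_b` is stable under the twisted action; `measurableSet_splitLocus` —
  `S_b` is Borel.
* `exists_eq_smul_of_dotProduct_invariant` — **two `GL_n(K)`-invariant Borel measures on `X`, finite
  on compact sets and carried by `S_b`, are proportional** (Weil's Lemme 22 at the split place, via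
  the generic orbit theorem with `G = GL_n(K)`); `…_ne_zero` with `c ≠ 0`.
* `exists_restrict_splitLocus_eq_smul` — restrictions to `S_b` of arbitrary invariant measures
  finite on compact sets are proportional.
* `exists_measure_prod_splitLocus_eq_mul` — the **relative form** over any measurable space `Y`
  (Weil's `X' =` the adelic space away from `v`): a measure on `X × Y` with invariant rectangle
  masses `μ (A ×ˢ B)` (`B` fixed), finite on `K ×ˢ B` for compact `K`, carried by `S_b ×ˢ B`,
  satisfies `μ (A ×ˢ B) = c_B · μ₀ A` for any non-zero invariant reference measure `μ₀` carried by
  `S_b` [Weil1965, n° 49 Lemme 22 (p. 70): `∫ Φ_v(x_v) Φ'(x') dμ = c(Φ') ∫ Φ_v dμ_v`].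

## References

* A. Weil, *Sur la formule de Siegel dans la théorie des groupes classiques*, Acta Math. 113
  (1965): n° 49 Lemme 22 (p. 70); n° 50 Thm 4 and its proof (39)–(40) (pp. 72–74) [Weil1965].
* G. B. Folland, *A Course in Abstract Harmonic Analysis* (1995), §2.6 Thm. 2.49 [Folland1995].
-/

noncomputable section

open _root_.MeasureTheory _root_.MeasureTheory.Measure _root_.Topology Set Filter Matrix
open Literature.NumberTheory.Automorphic
open scoped ENNReal NNReal Pointwise MatrixGroups

namespace Literature.NumberTheory.Weil1965.SplitPlace

/-! ### Algebra of the twisted action `(x, y) ↦ (g x, g⁻ᵀ y)` -/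

section Algebra

variable {K : Type*} [Field K] {n : Type*} [Fintype n] [DecidableEq n]

/-- The twisted action is trivial at `g = 1`. [cite: Weil1965, n° 49 Lemme 22 (p. 70), proof] -/
theorem mulVec_one_transpose_inv_one (z : (n → K) × (n → K)) :
    ((((1 : GL n K) : Matrix n n K) *ᵥ z.1,
      (((1 : GL n K)⁻¹ : GL n K) : Matrix n n K)ᵀ *ᵥ z.2) : (n → K) × (n → K)) = z := by
  rw [inv_one, Units.val_one, transpose_one, one_mulVec, one_mulVec]

/-- The twisted action is multiplicative: `T_{g h} = T_g ∘ T_h`.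
[cite: Weil1965, n° 49 Lemme 22 (p. 70), proof] -/
theorem mulVec_mul_transpose_inv_mul (g h : GL n K) (z : (n → K) × (n → K)) :
    ((((g * h : GL n K) : Matrix n n K) *ᵥ z.1,
      (((g * h)⁻¹ : GL n K) : Matrix n n K)ᵀ *ᵥ z.2) : (n → K) × (n → K)) =
      ((g : Matrix n n K) *ᵥ ((h : Matrix n n K) *ᵥ z.1),
        ((g⁻¹ : GL n K) : Matrix n n K)ᵀ *ᵥ (((h⁻¹ : GL n K) : Matrix n n K)ᵀ *ᵥ z.2)) := by
  rw [_root_.mul_inv_rev, Units.val_mul, Units.val_mul, transpose_mul, mulVec_mulVec, mulVec_mulVec]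

/-- The twisted action of `g⁻¹` undoes that of `g`.
[cite: Weil1965, n° 49 Lemme 22 (p. 70), proof] -/
theorem mulVec_inv_mulVec_transpose_inv (g : GL n K) (z : (n → K) × (n → K)) :
    ((((g⁻¹ : GL n K) : Matrix n n K) *ᵥ ((g : Matrix n n K) *ᵥ z.1),
      (((g⁻¹)⁻¹ : GL n K) : Matrix n n K)ᵀ *ᵥ (((g⁻¹ : GL n K) : Matrix n n K)ᵀ *ᵥ z.2)) :
        (n → K) × (n → K)) = z := by
  rw [← mulVec_mul_transpose_inv_mul, inv_mul_cancel, mulVec_one_transpose_inv_one]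

/-- The locus `S_b = {x ⬝ᵥ y = b, x ≠ 0, y ≠ 0}` is stable under the twisted action.
[cite: Weil1965, n° 49 Lemme 22 (p. 70), proof] -/
theorem mem_splitLocus_of_mem (b : K) (g : GL n K) {z : (n → K) × (n → K)}
    (hz : z ∈ {z : (n → K) × (n → K) | z.1 ⬝ᵥ z.2 = b ∧ z.1 ≠ 0 ∧ z.2 ≠ 0}) :
    (((g : Matrix n n K) *ᵥ z.1, ((g⁻¹ : GL n K) : Matrix n n K)ᵀ *ᵥ z.2) : (n → K) × (n → K)) ∈
      {z : (n → K) × (n → K) | z.1 ⬝ᵥ z.2 = b ∧ z.1 ≠ 0 ∧ z.2 ≠ 0} := by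
  obtain ⟨hb, hx, hy⟩ := hz
  refine ⟨by rw [GLnDotProduct.dotProduct_mulVec_transpose_inv_mulVec, hb], ?_, ?_⟩
  · intro h
    apply hx
    have := congrArg (fun v => ((g⁻¹ : GL n K) : Matrix n n K) *ᵥ v) h
    simpa only [mulVec_mulVec, Units.inv_mul, one_mulVec, mulVec_zero] using this
  · intro h
    apply hy
    have := congrArg (fun v => ((g : GL n K) : Matrix n n K)ᵀ *ᵥ v) h
    rw [mulVec_mulVec, ← transpose_mul, Units.inv_mul, transpose_one, one_mulVec, mulVec_zero]
      at this
    exact this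

end Algebra

/-! ### The split place: topology, Borel structure, the action built locally -/

section SplitPlace

variable {K : Type*} [Field K] [ValuativeRel K] [TopologicalSpace K] [IsNonarchimedeanLocalField K]
  [MeasurableSpace K] [BorelSpace K] {n : Type*} [Fintype n] [DecidableEq n]

omit [DecidableEq n] in
/-- The locus `S_b = {x ⬝ᵥ y = b, x ≠ 0, y ≠ 0} ⊆ Kⁿ × Kⁿ` is a Borel set.
[cite: Weil1965, n° 49 Lemme 22 (p. 70), proof] -/
theorem measurableSet_splitLocus (b : K) :
    MeasurableSet {z : (n → K) × (n → K) | z.1 ⬝ᵥ z.2 = b ∧ z.1 ≠ 0 ∧ z.2 ≠ 0} := by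
  haveI : SecondCountableTopology K := secondCountableTopology_localField K
  haveI : T2Space K := (GaloisRepresentations.IsNonarchimedeanLocalField.isLocalField K).toT2Space
  have h1 : IsClosed {z : (n → K) × (n → K) | z.1 ⬝ᵥ z.2 = b} :=
    isClosed_eq (continuous_fst.dotProduct continuous_snd) continuous_const
  have h2 : IsOpen {z : (n → K) × (n → K) | z.1 ≠ 0} :=
    isOpen_ne_fun continuous_fst continuous_const
  have h3 : IsOpen {z : (n → K) × (n → K) | z.2 ≠ 0} :=
    isOpen_ne_fun continuous_snd continuous_const
  have : {z : (n → K) × (n → K) | z.1 ⬝ᵥ z.2 = b ∧ z.1 ≠ 0 ∧ z.2 ≠ 0} =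
      {z : (n → K) × (n → K) | z.1 ⬝ᵥ z.2 = b} ∩ ({z | z.1 ≠ 0} ∩ {z | z.2 ≠ 0}) := by
    ext z; simp only [mem_setOf_eq, mem_inter_iff]
  rw [this]
  exact h1.measurableSet.inter (h2.measurableSet.inter h3.measurableSet)

/-- **Uniqueness of the invariant measure on a fibre of the split form** (Weil (1965), n° 49,
Lemme 22 at a split place; Folland (1995), Thm. 2.49). Let `K` be a non-archimedean local field,
`n` finite with `2 ≤ |n|`, `X = Kⁿ × Kⁿ`, `b : K`, `S_b = {(x, y) | x ⬝ᵥ y = b, x ≠ 0, y ≠ 0}` (one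
orbit of `GL_n(K)` under `(x, y) ↦ (g x, g⁻ᵀ y)`,
`Literature.NumberTheory.Automorphic.GLnDotProduct.exists_gl_mulVec_eq_and_transpose_inv_mulVec_eq`).
If `μ`, `μ'` are Borel measures on `X`, finite on compact sets, invariant under every
`(x, y) ↦ (g x, g⁻ᵀ y)` and carried by `S_b`, and `μ' ≠ 0`, then `μ = c • μ'` for some `c ≥ 0`.
Proof: manufacture the continuous action of the locally compact second countable group `GL_n(K)`
on `X`, identify `S_b` with one orbit, and apply
`Literature.MeasureTheory.Group.exists_eq_smul_of_measure_compl_orbit_eq_zero`.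
[cite: Weil1965, n° 49 Lemme 22 (p. 70)] [cite: Folland1995, §2.6 Thm. 2.49] -/
theorem exists_eq_smul_of_dotProduct_invariant (b : K) (μ μ' : Measure ((n → K) × (n → K)))
    [IsFiniteMeasureOnCompacts μ] [IsFiniteMeasureOnCompacts μ']
    (hμ : ∀ (g : GL n K) (A : Set ((n → K) × (n → K))), MeasurableSet A →
      μ ((fun z => (((g : Matrix n n K) *ᵥ z.1, ((g⁻¹ : GL n K) : Matrix n n K)ᵀ *ᵥ z.2) :
        (n → K) × (n → K))) ⁻¹' A) = μ A)
    (hμ' : ∀ (g : GL n K) (A : Set ((n → K) × (n → K))), MeasurableSet A →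
      μ' ((fun z => (((g : Matrix n n K) *ᵥ z.1, ((g⁻¹ : GL n K) : Matrix n n K)ᵀ *ᵥ z.2) :
        (n → K) × (n → K))) ⁻¹' A) = μ' A)
    (hcar : μ {z : (n → K) × (n → K) | z.1 ⬝ᵥ z.2 = b ∧ z.1 ≠ 0 ∧ z.2 ≠ 0}ᶜ = 0)
    (hcar' : μ' {z : (n → K) × (n → K) | z.1 ⬝ᵥ z.2 = b ∧ z.1 ≠ 0 ∧ z.2 ≠ 0}ᶜ = 0)
    (h0 : μ' ≠ 0)
    (h2 : 2 ≤ Fintype.card n) :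
    ∃ c : ℝ≥0, μ = c • μ' := by
  -- topology and Borel structure
  haveI : SecondCountableTopology K := secondCountableTopology_localField K
  haveI : T2Space K := (GaloisRepresentations.IsNonarchimedeanLocalField.isLocalField K).toT2Space
  haveI : LocallyCompactSpace (Matrix n n K) := inferInstanceAs (LocallyCompactSpace (n → n → K))
  haveI : SecondCountableTopology (Matrix n n K) :=
    inferInstanceAs (SecondCountableTopology (n → n → K))
  haveI : SecondCountableTopology (Matrix n n K)ᵐᵒᵖ :=
    MulOpposite.opHomeomorph.symm.secondCountableTopology
  haveI : SecondCountableTopology (GL n K) := Units.isEmbedding_embedProduct.secondCountableTopology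
  letI : MeasurableSpace (GL n K) := borel _
  haveI : BorelSpace (GL n K) := ⟨rfl⟩
  -- the twisted action, built locally (a LOCAL `SMul` first, so that it shadows Mathlib's
  -- diagonal action of `(Matrix n n K)ˣ` on `Kⁿ × Kⁿ` coming from `Module (Matrix n n K) (n → K)`)
  letI instS : SMul (GL n K) ((n → K) × (n → K)) :=
    ⟨fun g z => (((g : Matrix n n K) *ᵥ z.1, ((g⁻¹ : GL n K) : Matrix n n K)ᵀ *ᵥ z.2) :
        (n → K) × (n → K))⟩
  have hsmul : ∀ (g : GL n K) (z : (n → K) × (n → K)),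
      g • z = (((g : Matrix n n K) *ᵥ z.1, ((g⁻¹ : GL n K) : Matrix n n K)ᵀ *ᵥ z.2) :
        (n → K) × (n → K)) := fun _ _ => rfl
  letI : MulAction (GL n K) ((n → K) × (n → K)) :=
    { one_smul := fun z => by rw [hsmul]; exact mulVec_one_transpose_inv_one z
      mul_smul := fun g h z => by
        rw [hsmul, hsmul, hsmul]; exact mulVec_mul_transpose_inv_mul g h z }
  haveI : ContinuousSMul (GL n K) ((n → K) × (n → K)) := by
    refine ⟨?_⟩
    change Continuous fun p : GL n K × ((n → K) × (n → K)) =>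
      (((p.1 : Matrix n n K) *ᵥ p.2.1, ((p.1⁻¹ : GL n K) : Matrix n n K)ᵀ *ᵥ p.2.2) :
        (n → K) × (n → K))
    refine Continuous.prodMk ?_ ?_
    · exact (Units.continuous_val.comp continuous_fst).matrix_mulVec
        (continuous_fst.comp continuous_snd)
    · exact ((Units.continuous_coe_inv.comp continuous_fst).matrix_transpose).matrix_mulVec
        (continuous_snd.comp continuous_snd)
  haveI : SMulInvariantMeasure (GL n K) ((n → K) × (n → K)) μ := ⟨fun g A hA => hμ g A hA⟩
  haveI : SMulInvariantMeasure (GL n K) ((n → K) × (n → K)) μ' := ⟨fun g A hA => hμ' g A hA⟩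
  -- a base point on the locus: `μ' ≠ 0` is carried by `S_b`
  set S : Set ((n → K) × (n → K)) := {z | z.1 ⬝ᵥ z.2 = b ∧ z.1 ≠ 0 ∧ z.2 ≠ 0} with hSdef
  obtain ⟨z₀, hz₀⟩ : S.Nonempty := by
    by_contra hS
    rw [Set.not_nonempty_iff_eq_empty] at hS
    apply h0
    rw [← Measure.measure_univ_eq_zero, ← Set.compl_empty, ← hS]
    exact hcar'
  -- the locus is the orbit of `z₀`
  have horb : MulAction.orbit (GL n K) z₀ = S := by
    ext z
    constructor
    · rintro ⟨g, rfl⟩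
      rw [hSdef]
      exact mem_splitLocus_of_mem b g hz₀
    · intro hz
      obtain ⟨g, hg1, hg2⟩ :=
        GLnDotProduct.exists_gl_mulVec_eq_and_transpose_inv_mulVec_eq_of_dotProduct_eq h2 hz₀.2.1
          hz₀.2.2 hz.2.1 hz.2.2 hz₀.1 hz.1
      refine MulAction.mem_orbit_iff.2 ⟨g, ?_⟩
      rw [hsmul, hg1, hg2]
  rw [← horb] at hcar hcar'
  exact Literature.MeasureTheory.Group.exists_eq_smul_of_measure_compl_orbit_eq_zero (GL n K) z₀
    μ μ' hcar hcar' h0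

/-- **Uniqueness up to a positive constant** on a fibre of the split form: under the hypotheses of
`exists_eq_smul_of_dotProduct_invariant`, if also `μ ≠ 0` then `μ = c • μ'` with `c ≠ 0`.
[cite: Weil1965, n° 49 Lemme 22 (p. 70)] [cite: Folland1995, §2.6 Thm. 2.49] -/
theorem exists_eq_smul_of_dotProduct_invariant_ne_zero (b : K)
    (μ μ' : Measure ((n → K) × (n → K)))
    [IsFiniteMeasureOnCompacts μ] [IsFiniteMeasureOnCompacts μ']
    (hμ : ∀ (g : GL n K) (A : Set ((n → K) × (n → K))), MeasurableSet A →
      μ ((fun z => (((g : Matrix n n K) *ᵥ z.1, ((g⁻¹ : GL n K) : Matrix n n K)ᵀ *ᵥ z.2) :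
        (n → K) × (n → K))) ⁻¹' A) = μ A)
    (hμ' : ∀ (g : GL n K) (A : Set ((n → K) × (n → K))), MeasurableSet A →
      μ' ((fun z => (((g : Matrix n n K) *ᵥ z.1, ((g⁻¹ : GL n K) : Matrix n n K)ᵀ *ᵥ z.2) :
        (n → K) × (n → K))) ⁻¹' A) = μ' A)
    (hcar : μ {z : (n → K) × (n → K) | z.1 ⬝ᵥ z.2 = b ∧ z.1 ≠ 0 ∧ z.2 ≠ 0}ᶜ = 0)
    (hcar' : μ' {z : (n → K) × (n → K) | z.1 ⬝ᵥ z.2 = b ∧ z.1 ≠ 0 ∧ z.2 ≠ 0}ᶜ = 0)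
    (h0 : μ ≠ 0) (h0' : μ' ≠ 0)
    (h2 : 2 ≤ Fintype.card n) :
    ∃ c : ℝ≥0, c ≠ 0 ∧ μ = c • μ' := by
  obtain ⟨c, hc⟩ := exists_eq_smul_of_dotProduct_invariant b μ μ' hμ hμ' hcar hcar' h0' h2
  refine ⟨c, ?_, hc⟩
  rintro rfl
  rw [zero_smul] at hc
  exact h0 hc

/-- **Restrictions to a fibre are proportional.** For two Borel measures `μ`, `μ'` on `Kⁿ × Kⁿ`,
finite on compact sets and invariant under every `(x, y) ↦ (g x, g⁻ᵀ y)`, `g ∈ GL_n(K)` (not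
necessarily carried by the fibre — e.g. the difference measures `E''` of Weil's proof of Thm 4,
which are sums over `b` of measures carried by the `S_b`): if `μ'|_{S_b} ≠ 0` then
`μ|_{S_b} = c • μ'|_{S_b}` for some `c ≥ 0` (`2 ≤ |n|`). [cite: Weil1965, n° 49 Lemme 22 (p. 70)]
[cite: Folland1995, §2.6 Thm. 2.49] -/
theorem exists_restrict_splitLocus_eq_smul (b : K) (μ μ' : Measure ((n → K) × (n → K)))
    [IsFiniteMeasureOnCompacts μ] [IsFiniteMeasureOnCompacts μ']
    (hμ : ∀ (g : GL n K) (A : Set ((n → K) × (n → K))), MeasurableSet A →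
      μ ((fun z => (((g : Matrix n n K) *ᵥ z.1, ((g⁻¹ : GL n K) : Matrix n n K)ᵀ *ᵥ z.2) :
        (n → K) × (n → K))) ⁻¹' A) = μ A)
    (hμ' : ∀ (g : GL n K) (A : Set ((n → K) × (n → K))), MeasurableSet A →
      μ' ((fun z => (((g : Matrix n n K) *ᵥ z.1, ((g⁻¹ : GL n K) : Matrix n n K)ᵀ *ᵥ z.2) :
        (n → K) × (n → K))) ⁻¹' A) = μ' A)
    (h0 : μ'.restrict {z : (n → K) × (n → K) | z.1 ⬝ᵥ z.2 = b ∧ z.1 ≠ 0 ∧ z.2 ≠ 0} ≠ 0)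
    (h2 : 2 ≤ Fintype.card n) :
    ∃ c : ℝ≥0, μ.restrict {z : (n → K) × (n → K) | z.1 ⬝ᵥ z.2 = b ∧ z.1 ≠ 0 ∧ z.2 ≠ 0} =
      c • μ'.restrict {z : (n → K) × (n → K) | z.1 ⬝ᵥ z.2 = b ∧ z.1 ≠ 0 ∧ z.2 ≠ 0} := by
  haveI : SecondCountableTopology K := secondCountableTopology_localField K
  haveI : T2Space K := (GaloisRepresentations.IsNonarchimedeanLocalField.isLocalField K).toT2Space
  set S : Set ((n → K) × (n → K)) := {z | z.1 ⬝ᵥ z.2 = b ∧ z.1 ≠ 0 ∧ z.2 ≠ 0} with hSdef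
  have hS : MeasurableSet S := measurableSet_splitLocus b
  -- the maps `T_g` are measurable and `S` is `T_g`-stable
  have hT : ∀ g : GL n K, Measurable (fun z : (n → K) × (n → K) =>
      (((g : Matrix n n K) *ᵥ z.1, ((g⁻¹ : GL n K) : Matrix n n K)ᵀ *ᵥ z.2) :
        (n → K) × (n → K))) := fun g =>
    ((continuous_const.matrix_mulVec continuous_fst).prodMk
      (continuous_const.matrix_mulVec continuous_snd)).measurable
  have hpre : ∀ g : GL n K, (fun z : (n → K) × (n → K) =>
      (((g : Matrix n n K) *ᵥ z.1, ((g⁻¹ : GL n K) : Matrix n n K)ᵀ *ᵥ z.2) :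
        (n → K) × (n → K))) ⁻¹' S = S := by
    intro g
    ext z
    simp only [mem_preimage]
    constructor
    · intro hz
      have h' := mem_splitLocus_of_mem b g⁻¹ hz
      rw [mulVec_inv_mulVec_transpose_inv] at h'
      rw [hSdef]
      exact h'
    · intro hz
      exact mem_splitLocus_of_mem b g hz
  -- invariance of the restrictions
  have hres : ∀ ν : Measure ((n → K) × (n → K)),
      (∀ (g : GL n K) (A : Set ((n → K) × (n → K))), MeasurableSet A →
        ν ((fun z => (((g : Matrix n n K) *ᵥ z.1, ((g⁻¹ : GL n K) : Matrix n n K)ᵀ *ᵥ z.2) :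
          (n → K) × (n → K))) ⁻¹' A) = ν A) →
      ∀ (g : GL n K) (A : Set ((n → K) × (n → K))), MeasurableSet A →
        ν.restrict S ((fun z => (((g : Matrix n n K) *ᵥ z.1,
          ((g⁻¹ : GL n K) : Matrix n n K)ᵀ *ᵥ z.2) : (n → K) × (n → K))) ⁻¹' A) =
          ν.restrict S A := by
    intro ν hν g A hA
    rw [Measure.restrict_apply ((hT g) hA), Measure.restrict_apply hA]
    conv_lhs => rw [← hpre g, ← Set.preimage_inter]
    exact hν g _ (hA.inter hS)
  have hc : ∀ ν : Measure ((n → K) × (n → K)), ν.restrict S Sᶜ = 0 := fun ν => by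
    rw [Measure.restrict_apply hS.compl, Set.compl_inter_self, measure_empty]
  exact exists_eq_smul_of_dotProduct_invariant b (μ.restrict S) (μ'.restrict S) (hres μ hμ)
    (hres μ' hμ') (hc μ) (hc μ') h0 h2

/-! ### The relative form over an auxiliary measurable space -/

variable {Y : Type*} [MeasurableSpace Y]

omit [Field K] [ValuativeRel K] [TopologicalSpace K] [IsNonarchimedeanLocalField K]
  [BorelSpace K] [Fintype n] [DecidableEq n] in
/-- The `B`-marginal `A ↦ μ (A ×ˢ B)` of a measure on `X × Y` is the measure
`(μ|_{X ×ˢ B}).map Prod.fst`. [folklore] -/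
private theorem map_fst_restrict_univ_prod_apply' (μ : Measure (((n → K) × (n → K)) × Y))
    {B : Set Y} {A : Set ((n → K) × (n → K))} (hA : MeasurableSet A) :
    (μ.restrict (Set.univ ×ˢ B)).map Prod.fst A = μ (A ×ˢ B) := by
  rw [Measure.map_apply measurable_fst hA, Measure.restrict_apply (measurable_fst hA),
    ← Set.prod_univ, Set.prod_inter_prod, Set.inter_univ, Set.univ_inter]

/-- **Weil's Lemme 22 at the split place, relative form** (Weil (1965), n° 49, Lemme 22:
`∫ Φ_v(x_v) Φ'(x') dμ((x_v, x')) = c(Φ') ∫ Φ_v dμ_v` for a positive measure on `X_v × X'` carried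
by `U(b)_v × X'` and invariant under a group acting transitively on `U(b)_v`). Let `K` be a
non-archimedean local field, `2 ≤ |n|`, `X = Kⁿ × Kⁿ`, `b : K`, `S_b = {x ⬝ᵥ y = b, x ≠ 0, y ≠ 0}`,
`μ₀ ≠ 0` a Borel measure on `X` finite on compact sets,
invariant under every `(x, y) ↦ (g x, g⁻ᵀ y)` and carried by `S_b`. Let `Y` be any measurable space,
`μ` a measure on `X × Y` and `B ⊆ Y` with: `μ (C ×ˢ B) < ∞` for compact `C`, the rectangle masses
`μ (A ×ˢ B)` are invariant (`μ (T_g⁻¹ A ×ˢ B) = μ (A ×ˢ B)` for Borel `A`), and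
`μ (S_bᶜ ×ˢ B) = 0`. Then `μ (A ×ˢ B) = c_B · μ₀ A` for some `c_B ≥ 0` and every Borel `A ⊆ X`.
[cite: Weil1965, n° 49 Lemme 22 (p. 70)] [cite: Folland1995, §2.6 Thm. 2.49] -/
theorem exists_measure_prod_splitLocus_eq_mul (b : K) (μ₀ : Measure ((n → K) × (n → K)))
    [IsFiniteMeasureOnCompacts μ₀]
    (hμ₀ : ∀ (g : GL n K) (A : Set ((n → K) × (n → K))), MeasurableSet A →
      μ₀ ((fun z => (((g : Matrix n n K) *ᵥ z.1, ((g⁻¹ : GL n K) : Matrix n n K)ᵀ *ᵥ z.2) :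
        (n → K) × (n → K))) ⁻¹' A) = μ₀ A)
    (hμ₀c : μ₀ {z : (n → K) × (n → K) | z.1 ⬝ᵥ z.2 = b ∧ z.1 ≠ 0 ∧ z.2 ≠ 0}ᶜ = 0)
    (hμ₀0 : μ₀ ≠ 0)
    (μ : Measure (((n → K) × (n → K)) × Y)) {B : Set Y}
    (hfin : ∀ C : Set ((n → K) × (n → K)), IsCompact C → μ (C ×ˢ B) < ∞)
    (hinv : ∀ (g : GL n K) (A : Set ((n → K) × (n → K))), MeasurableSet A →
      μ (((fun z => (((g : Matrix n n K) *ᵥ z.1, ((g⁻¹ : GL n K) : Matrix n n K)ᵀ *ᵥ z.2) :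
        (n → K) × (n → K))) ⁻¹' A) ×ˢ B) = μ (A ×ˢ B))
    (hcar : μ ({z : (n → K) × (n → K) | z.1 ⬝ᵥ z.2 = b ∧ z.1 ≠ 0 ∧ z.2 ≠ 0}ᶜ ×ˢ B) = 0)
    (h2 : 2 ≤ Fintype.card n) :
    ∃ c : ℝ≥0, ∀ A : Set ((n → K) × (n → K)), MeasurableSet A → μ (A ×ˢ B) = c * μ₀ A := by
  haveI : SecondCountableTopology K := secondCountableTopology_localField K
  haveI : T2Space K := (GaloisRepresentations.IsNonarchimedeanLocalField.isLocalField K).toT2Space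
  -- the `B`-marginal on `X`
  set ν : Measure ((n → K) × (n → K)) := (μ.restrict (Set.univ ×ˢ B)).map Prod.fst with hνdef
  have hν : ∀ A : Set ((n → K) × (n → K)), MeasurableSet A → ν A = μ (A ×ˢ B) := fun A hA =>
    map_fst_restrict_univ_prod_apply' μ hA
  have hT : ∀ g : GL n K, Measurable (fun z : (n → K) × (n → K) =>
      (((g : Matrix n n K) *ᵥ z.1, ((g⁻¹ : GL n K) : Matrix n n K)ᵀ *ᵥ z.2) :
        (n → K) × (n → K))) := fun g =>
    ((continuous_const.matrix_mulVec continuous_fst).prodMk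
      (continuous_const.matrix_mulVec continuous_snd)).measurable
  have hνinv : ∀ (g : GL n K) (A : Set ((n → K) × (n → K))), MeasurableSet A →
      ν ((fun z => (((g : Matrix n n K) *ᵥ z.1, ((g⁻¹ : GL n K) : Matrix n n K)ᵀ *ᵥ z.2) :
        (n → K) × (n → K))) ⁻¹' A) = ν A := by
    intro g A hA
    rw [hν A hA, hν _ ((hT g) hA), hinv g A hA]
  haveI : IsFiniteMeasureOnCompacts ν := by
    refine ⟨fun C hC => ?_⟩
    rw [hν C hC.measurableSet]
    exact hfin C hC
  have hνc : ν {z : (n → K) × (n → K) | z.1 ⬝ᵥ z.2 = b ∧ z.1 ≠ 0 ∧ z.2 ≠ 0}ᶜ = 0 := by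
    rw [hν _ (measurableSet_splitLocus b).compl]
    exact hcar
  obtain ⟨c, hc⟩ :=
    exists_eq_smul_of_dotProduct_invariant b ν μ₀ hνinv hμ₀ hνc hμ₀c hμ₀0 h2
  refine ⟨c, fun A hA => ?_⟩
  rw [← hν A hA, hc, Measure.coe_nnreal_smul_apply]

/-- The `∫⁻` form of `exists_measure_prod_splitLocus_eq_mul`: with `B` measurable, there is
`c_B ≥ 0` with `∫⁻ (z, y), f z · 1_B y dμ = c_B · ∫⁻ z, f z dμ₀` for every Borel
`f : Kⁿ × Kⁿ → [0, ∞]` — Weil's `μ(Φ_v ⊗ Φ') = c(Φ') μ_v(Φ_v)` on product test functions.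
[cite: Weil1965, n° 49 Lemme 22 (p. 70)] [cite: Folland1995, §2.6 Thm. 2.49] -/
theorem exists_lintegral_fst_mul_indicator_snd_splitLocus_eq_mul (b : K)
    (μ₀ : Measure ((n → K) × (n → K))) [IsFiniteMeasureOnCompacts μ₀]
    (hμ₀ : ∀ (g : GL n K) (A : Set ((n → K) × (n → K))), MeasurableSet A →
      μ₀ ((fun z => (((g : Matrix n n K) *ᵥ z.1, ((g⁻¹ : GL n K) : Matrix n n K)ᵀ *ᵥ z.2) :
        (n → K) × (n → K))) ⁻¹' A) = μ₀ A)
    (hμ₀c : μ₀ {z : (n → K) × (n → K) | z.1 ⬝ᵥ z.2 = b ∧ z.1 ≠ 0 ∧ z.2 ≠ 0}ᶜ = 0)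
    (hμ₀0 : μ₀ ≠ 0)
    (μ : Measure (((n → K) × (n → K)) × Y)) {B : Set Y} (hB : MeasurableSet B)
    (hfin : ∀ C : Set ((n → K) × (n → K)), IsCompact C → μ (C ×ˢ B) < ∞)
    (hinv : ∀ (g : GL n K) (A : Set ((n → K) × (n → K))), MeasurableSet A →
      μ (((fun z => (((g : Matrix n n K) *ᵥ z.1, ((g⁻¹ : GL n K) : Matrix n n K)ᵀ *ᵥ z.2) :
        (n → K) × (n → K))) ⁻¹' A) ×ˢ B) = μ (A ×ˢ B))
    (hcar : μ ({z : (n → K) × (n → K) | z.1 ⬝ᵥ z.2 = b ∧ z.1 ≠ 0 ∧ z.2 ≠ 0}ᶜ ×ˢ B) = 0)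
    (h2 : 2 ≤ Fintype.card n) :
    ∃ c : ℝ≥0, ∀ f : (n → K) × (n → K) → ℝ≥0∞, Measurable f →
      ∫⁻ p, f p.1 * B.indicator 1 p.2 ∂μ = c * ∫⁻ z, f z ∂μ₀ := by
  obtain ⟨c, hc⟩ := exists_measure_prod_splitLocus_eq_mul b μ₀ hμ₀ hμ₀c hμ₀0 μ hfin hinv hcar h2
  refine ⟨c, fun f hf => ?_⟩
  set ν : Measure ((n → K) × (n → K)) := (μ.restrict (Set.univ ×ˢ B)).map Prod.fst with hνdef
  have hν : ν = c • μ₀ := by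
    ext A hA
    rw [hνdef, map_fst_restrict_univ_prod_apply' μ hA, hc A hA, Measure.coe_nnreal_smul_apply]
  have h1 : ∫⁻ p, f p.1 * B.indicator 1 p.2 ∂μ = ∫⁻ x, f x ∂ν := by
    rw [hνdef, lintegral_map hf measurable_fst,
      ← lintegral_indicator (MeasurableSet.univ.prod hB)]
    congr 1
    funext p
    by_cases hp : p.2 ∈ B
    · rw [Set.indicator_of_mem (show p ∈ Set.univ ×ˢ B from ⟨Set.mem_univ _, hp⟩),
        Set.indicator_of_mem hp, Pi.one_apply, mul_one]
    · rw [Set.indicator_of_notMem (show p ∉ Set.univ ×ˢ B from fun h => hp h.2),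
        Set.indicator_of_notMem hp, mul_zero]
  rw [h1, hν, lintegral_smul_measure]
  rfl

end SplitPlace

end Literature.NumberTheory.Weil1965.SplitPlace
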